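import Mathlib.Analysis.Calculus.InverseFunctionTheorem.Deriv
import Literature.Probability.RandomPlanarGeometry.LoewnerSlidHullStar
import Literature.Probability.RandomPlanarGeometry.LoewnerBoundaryExtension
import Literature.Probability.RandomPlanarGeometry.HullDecomposition
import Literature.Probability.RandomPlanarGeometry.ArcHullSlits
import HarnessLib

/-!
# Slid hulls of arc `+`-hulls are arc `+`-hulls ([LSW] §8.4: "Applying this with `A* = g_t(A)`")

G. F. Lawler, O. Schramm, W. Werner, *Conformal restriction: the chordal case*, J. Amer. Math.
Soc. **16** (2003) 917–955, arXiv:math/0209343 (**[LSW]**), proof of Lemma 8.10: "the following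
argument shows that `g_{A*}'` is monotone decreasing on `x < inf(A* ∩ ℝ)` for every smooth hull
`A*`. Applying this with `A* = g_t(A)` then yields (8.2)" — which presupposes that the hull
`A_t = g_t(A)` (equivalently the slid hull `A_t − W_t`, `Loewner.slidHull`) of the smooth hull
`A ∈ 𝒬₊` is again a smooth hull of `𝒬₊` before the hitting time `T_A`. This file PROVES the
topological form the tree's slit Loewner theorem needs (`IsArcHull`, hulls bounded by a Jordan
arc with real endpoints, `HullApproximation`), for every continuous driving function:

* `Loewner.isPlusHull_slidHull_of_disjoint` — for `A ∈ 𝒬₊` missed by the closed hull `K̂_t` of a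
  driving function with `W_0 = 0`, the slid hull `g_t(A) − W_t` is in `𝒬₊` (its real points are
  `g_t(x) − W_t > 0`, `x ∈ A ∩ ℝ ⊆ (0, ∞)`: real points to the right of `W_0` stay to the right,
  `driving_lt_map_ofReal_re`);
* `Loewner.isArcHull_slidHull_of_disjoint` — for an arc hull `A ∌ 0` missed by `K̂_t`, the
  slid hull is an arc hull, bounded by the image arc `(g_t − W_t) ∘ γ`: `g_t − W_t` is continuous
  and injective on the open set of flowing points `{T_z > t} ⊇ A` and open at each of its points
  (non-vanishing strict derivative, `exists_hasStrictDerivAt_map`, and the inverse function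
  theorem `HasStrictDerivAt.map_nhds_eq`), so it carries `ℍ ∩ ∂A` onto `ℍ ∩ ∂(g_t(A) − W_t)`.
-/

noncomputable section

open Set Filter Metric Complex
open _root_.Topology
open UpperHalfPlane (upperHalfPlaneSet isOpen_upperHalfPlaneSet)
open scoped NNReal

namespace Literature.Probability.RandomPlanarGeometry

namespace Loewner

variable {W : ℝ≥0 → ℝ} {A : Set ℂ} {t : ℝ≥0}

/-- The driving point `W_0` lies in every closed hull (`T_{W_0} = 0`). [folklore] -/
theorem driving_mem_closedHull (W : ℝ≥0 → ℝ) (t : ℝ≥0) : (W 0 : ℂ) ∈ closedHull W t :=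
  ⟨by simp, (swallowingTime_driving_le W).trans bot_le⟩

/-- A real point of a hull missed by `K̂_t`, for a driving function with `W_0 = 0` and a `+`-hull,
slides to a POSITIVE real point: `g_t(x) − W_t > 0`. [folklore] -/
theorem slidHull_real_pos (hW : Continuous W) (hW0 : W 0 = 0) (hA : IsPlusHull A)
    (hdisj : Disjoint (closedHull W t) A) {r : ℝ} (hr : (r : ℂ) ∈ slidHull W A t) : 0 < r := by
  obtain ⟨a, ha, har⟩ := hr
  have haT : (t : WithTop ℝ≥0) < swallowingTime W a :=
    lt_swallowingTime_of_disjoint_closedHull hA.1.isBoundedHull.subset_closure hdisj ha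
  have him0 : 0 ≤ a.im := hA.1.isBoundedHull.im_nonneg ha
  rcases him0.lt_or_eq with hpos | hzero
  · -- a point of `ℍ` slides into `ℍ`, not onto the real line
    have h1 : 0 < (map W t a).im := mapsTo_map hW t ((mem_domain_iff W t a).2 ⟨hpos, haT⟩)
    have h2 := congrArg Complex.im har
    simp at h2
    linarith
  · have hare : a = ((a.re : ℝ) : ℂ) := Complex.ext (by simp) (by simp [← hzero])
    rw [hare] at ha haT har
    have hx : W 0 < a.re := by rw [hW0]; exact hA.2 _ ha
    have h := driving_lt_map_ofReal_re hW hx haT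
    have h2 := congrArg Complex.re har
    simp only [Complex.sub_re, Complex.ofReal_re] at h2
    linarith

/-- **The slid hull of a `+`-hull missed by `K̂_t` is a `+`-hull** (driving function with
`W_0 = 0`): it is a `*`-hull (`isStarHull_slidHull_of_disjoint`) whose real points
`g_t(x) − W_t`, `x ∈ A ∩ ℝ ⊆ (0, ∞)`, are positive. [cite: LawlerSchrammWerner2003Restriction, §5 (A_t = g_t(A), t < T) and proof of Lemma 8.10 (A* = g_t(A))] -/
theorem isPlusHull_slidHull_of_disjoint (hW : Continuous W) (hW0 : W 0 = 0) (hA : IsPlusHull A)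
    (hdisj : Disjoint (closedHull W t) A) : IsPlusHull (slidHull W A t) :=
  ⟨isStarHull_slidHull_of_disjoint hW hA.1 hdisj, fun _ hr ↦ slidHull_real_pos hW hW0 hA hdisj hr⟩

/-- **The slid hull of an arc hull missed by `K̂_t` is an arc hull** (for `A ∌ 0`), bounded by
the image `(g_t − W_t) ∘ γ` of the boundary arc `γ` of `A`. [cite: LawlerSchrammWerner2003Restriction, proof of Lemma 8.10 ("Applying this with A* = g_t(A)")] -/
theorem isArcHull_slidHull_of_disjoint (hW : Continuous W) (hA : IsArcHull A) (hA0 : (0 : ℂ) ∉ A)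
    (hdisj : Disjoint (closedHull W t) A) : IsArcHull (slidHull W A t) := by
  classical
  obtain ⟨-, γ, hγc, hγi, h0, h1, hI, hfr⟩ := id hA
  set O : Set ℂ := {z : ℂ | (t : WithTop ℝ≥0) < swallowingTime W z} with hO
  set c : ℂ := (W t : ℂ) with hc
  set h : ℂ → ℂ := fun z ↦ map W t z - c with hh
  have hbd' : IsBoundedHull A := hA.isBoundedHull
  have hAO : A ⊆ O := fun a ha ↦ lt_swallowingTime_of_disjoint_closedHull hbd'.subset_closure hdisj ha
  have hOo : IsOpen O := isOpen_setOf_lt_swallowingTime hW t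
  have hcont : ∀ z ∈ O, ContinuousAt h z := fun z hz ↦ (continuousAt_map hW hz).sub continuousAt_const
  have hinj : InjOn h O := fun z hz w hw heq ↦
    injOn_map_of_lt_swallowingTime hW t hz hw (sub_left_injective heq)
  have hopen : ∀ z ∈ O, Filter.map h (𝓝 z) = 𝓝 (h z) := by
    intro z hz
    obtain ⟨d, hd0, hd⟩ := exists_hasStrictDerivAt_map hW hz
    have hg : Filter.map (map W t) (𝓝 z) = 𝓝 (map W t z) := hd.map_nhds_eq hd0
    have hfun : h = (Homeomorph.addRight (-c)) ∘ map W t := by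
      funext w
      simp [hh, sub_eq_add_neg]
    rw [hfun, ← Filter.map_map, hg, (Homeomorph.addRight (-c)).map_nhds_eq]
    simp
  have hγA : γ '' Icc 0 1 ⊆ A := hA.image_Icc_subset hγc hfr
  -- real points slide to real points, points of `ℍ` into `ℍ`
  have hreal : ∀ a ∈ A, a.im = 0 → (h a).im = 0 := by
    intro a ha ha0
    have hare : a = ((a.re : ℝ) : ℂ) := Complex.ext (by simp) (by simp [ha0])
    have haT := hAO ha
    rw [hare] at haT ⊢
    simp [hh, hc, map_ofReal_im hW haT]
  have hpos : ∀ a ∈ A, 0 < a.im → 0 < (h a).im := fun a ha hapos ↦ by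
    have := mapsTo_map hW t ((mem_domain_iff W t a).2 ⟨hapos, hAO ha⟩)
    simpa [hh, hc] using this
  have hstar : IsStarHull (slidHull W A t) := isStarHull_slidHull_of_disjoint hW ⟨hbd', hA0⟩ hdisj
  have hBcl : IsClosed (slidHull W A t) := hstar.isBoundedHull.isClosed
  -- the boundary arc of the slid hull
  refine ⟨hstar.isBoundedHull, fun s ↦ h (γ s), ?_, ?_, ?_, ?_, ?_, ?_⟩
  · -- continuity on `[0, 1]`
    intro s hs
    exact (hcont _ (hAO (hγA ⟨s, hs, rfl⟩))).comp_continuousWithinAt (hγc s hs)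
  · -- injectivity on `[0, 1]`
    intro s hs s' hs' heq
    exact hγi hs hs' (hinj (hAO (hγA ⟨s, hs, rfl⟩)) (hAO (hγA ⟨s', hs', rfl⟩)) heq)
  · exact hreal _ (hγA ⟨0, ⟨le_rfl, zero_le_one⟩, rfl⟩) h0
  · exact hreal _ (hγA ⟨1, ⟨zero_le_one, le_rfl⟩, rfl⟩) h1
  · intro s hs
    exact hpos _ (hγA ⟨s, Ioo_subset_Icc_self hs, rfl⟩) (hI s hs)
  · -- `ℍ ∩ ∂(h(A)) = h(γ(0,1))`
    ext w
    constructor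
    · rintro ⟨hwH, hwfr⟩
      -- `w = h z` with `z ∈ A`
      have hwB : w ∈ slidHull W A t := frontier_subset_iff_isClosed.2 hBcl hwfr
      obtain ⟨z, hzA, rfl⟩ := hwB
      have hzim : 0 < z.im := by
        rcases (hA.isBoundedHull.im_nonneg hzA).lt_or_eq with hlt | heq
        · exact hlt
        · exfalso
          have := hreal z hzA heq.symm
          exact absurd this (ne_of_gt hwH)
      -- `z ∈ ∂A`: an interior point of `A` would slide to an interior point of `h(A)`
      have hzfr : z ∈ frontier A := by
        refine ⟨subset_closure hzA, fun hzint ↦ hwfr.2 ?_⟩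
        rw [mem_interior_iff_mem_nhds] at hzint ⊢
        rw [← hopen z (hAO hzA)]
        exact Filter.image_mem_map hzint
      have hzγ : z ∈ γ '' Ioo 0 1 := by rw [← hfr]; exact ⟨hzim, hzfr⟩
      obtain ⟨s, hs, rfl⟩ := hzγ
      exact ⟨s, hs, rfl⟩
    · rintro ⟨s, hs, rfl⟩
      have hzγ : γ s ∈ upperHalfPlaneSet ∩ frontier A := by rw [hfr]; exact ⟨s, hs, rfl⟩
      obtain ⟨hzH, hzfr⟩ := hzγ
      have hzA : γ s ∈ A := hγA ⟨s, Ioo_subset_Icc_self hs, rfl⟩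
      refine ⟨hpos _ hzA hzH, subset_closure ⟨γ s, hzA, rfl⟩, fun hwint ↦ hzfr.2 ?_⟩
      -- an interior point of `h(A)` comes from an interior point of `A` (continuity + injectivity)
      rw [mem_interior_iff_mem_nhds] at hwint ⊢
      have h1 : h ⁻¹' (h '' A) ∈ 𝓝 (γ s) := (hcont _ (hAO hzA)).preimage_mem_nhds hwint
      have h2 : O ∈ 𝓝 (γ s) := hOo.mem_nhds (hAO hzA)
      filter_upwards [h1, h2] with u hu huO
      obtain ⟨a, ha, hau⟩ := hu
      rwa [← hinj (hAO ha) huO hau]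

end Loewner

end Literature.Probability.RandomPlanarGeometry

end
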